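import Summits.AtomisticToContinuum.BoseEinsteinCondensation.Theorems.BECGroundStateSOSPeriodicIRBoundPFTruncFamily
import Literature.MathematicalPhysics.QuantumManyBody.PeriodicMaxFormBoundHardCore
import HarnessLib

/-!
# Fixed-volume energy convergence along an arbitrary monotone tower of minorants: stub
# `stub_towerEnergyConvergence` (W-A) of line `near-minimiser-slack-transfer`, crux
# `BECConjugateDomination.HardCoreExtension` (stmt-AtomisticToContinuum-11786)

At fixed `(N, L)` with `L > 0` and `E₀(v) < ⊤`, for a repulsive finite-range `v` (hard cores allowed) and ANY
tower of measurable profiles `w₀ ≤ w₁ ≤ … ↑ v` (pointwise), the periodic ground-state energies converge: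
`E₀(v) ≤ E₀(wₙ) + ε` for all large `n` (the other inequality `E₀(wₙ) ≤ E₀(v)` is monotonicity). This is the
landed (α') `stub_truncationEnergyConvergenceAll` (tower `min(v, n)`) with the truncation tower replaced by an
arbitrary monotone measurable tower:

* the compactness half (Rellich through the free form domain + lower semicontinuity + Fatou + Beppo Levi) is
  `exists_limitProfile_family` of `…BECGroundStateSOSPeriodicIRBoundPFTruncFamily.lean` (the family version of
  `exists_limitProfile`): a unit Bose-symmetric `η ∈ L²((ℝ/ℤ)^{3N})` with maximal-form `v`-energy `≤ ⨆ₙ E₀(wₙ)`;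
* the maximal-form bound for EVERY repulsive finite-range potential, hard cores included,
  `maxFormBound_of_isRepulsiveFiniteRange` (`PeriodicMaxFormBoundHardCore.lean`) gives `E₀(v) ≤` that energy;
* hence `E₀(v) ≤ ⨆ₙ E₀(wₙ) < ⊤`, and `E₀(wₙ) ↑ ⨆ₙ E₀(wₙ)` in `ℝ≥0∞` (`ENNReal.tendsto_atTop`).

References: B. Simon, J. Funct. Anal. 28 (1978) 377–385 (monotone convergence of forms); B. Simon,
J. Operator Theory 1 (1979) 37–47; [ReedSimonIV1978] Thm. XIII.64.
-/

noncomputable section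

namespace Summit.AtomisticToContinuum.BoseEinsteinCondensation.Cruxes.HardCoreExtension.NearMinTower

open MeasureTheory Filter
open scoped ENNReal NNReal Topology
open Literature.MathematicalPhysics.QuantumManyBody.BoseGas
open Summit.AtomisticToContinuum.BoseEinsteinCondensation.Cruxes.PeriodicIRBound.LinearPhFloorWagner

-- No measure-space instance on `ℝ/ℤ` is activated here: the limit profile `η ∈ L²((ℝ/ℤ)^{3N}, Haar)` of
-- `exists_limitProfile_family` is handed straight to `maxFormBound_of_isRepulsiveFiniteRange`, both stated for
-- the Haar probability measure of `PeriodicFormDomain.lean`.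

/-- **`⨆ₙ E₀(wₙ) = E₀(v)` along a monotone measurable tower of a repulsive finite-range `v`** at fixed `(N, L)`,
`L > 0`, `E₀(v) < ⊤` (hard cores allowed): `≤` is monotonicity, `≥` is the compactness half
`exists_limitProfile_family` followed by the maximal-form bound `maxFormBound_of_isRepulsiveFiniteRange`.
[cite: ReedSimonIV1978, Thm. XIII.64] -/
theorem iSup_periodicGroundStateEnergy_tower {v : ℝ → ℝ≥0∞} (hv : IsRepulsiveFiniteRange v)
    {w : ℕ → ℝ → ℝ≥0∞} (hwm : ∀ n, Measurable (w n)) (hmono : ∀ r, Monotone fun n => w n r)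
    (hsup : ∀ r, ⨆ n, w n r = v r) {N : ℕ} {L : ℝ} (hL : 0 < L)
    (hE : periodicGroundStateEnergy v N L ≠ ⊤) :
    ⨆ n : ℕ, periodicGroundStateEnergy (w n) N L = periodicGroundStateEnergy v N L := by
  have hsup_le : (⨆ n : ℕ, periodicGroundStateEnergy (w n) N L) ≤ periodicGroundStateEnergy v N L :=
    iSup_le fun n => periodicGroundStateEnergy_family_le hmono hsup n N L
  refine le_antisymm hsup_le ?_
  obtain ⟨η, hη1, hηsymm, hηE⟩ :=
    exists_limitProfile_family hwm hmono hsup hL (ne_top_of_le_ne_top hE hsup_le)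
  exact (maxFormBound_of_isRepulsiveFiniteRange v hv N L hL η hη1 hηsymm).trans hηE

/-- **W-A `stub_towerEnergyConvergence`** (line `near-minimiser-slack-transfer`, crux `HardCoreExtension`): for a
repulsive finite-range `v`, a tower of measurable profiles `wₙ ≤ wₙ₊₁` with `⨆ₙ wₙ = v` pointwise, `L > 0` and
`E₀(v) < ⊤`, one has `E₀(v) ≤ E₀(wₙ) + ε` for all large `n` (`iSup_periodicGroundStateEnergy_tower` and
`E₀(wₙ) ↑ ⨆ₙ E₀(wₙ)` in `ℝ≥0∞`). [cite: ReedSimonIV1978, Thm. XIII.64] -/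
theorem stub_towerEnergyConvergence :
    ∀ v : ℝ → ℝ≥0∞, IsRepulsiveFiniteRange v → ∀ w : ℕ → ℝ → ℝ≥0∞, (∀ n, Measurable (w n)) →
      (∀ n r, w n r ≤ w (n + 1) r) → (∀ r, ⨆ n, w n r = v r) →
      ∀ (N : ℕ) (L : ℝ), 0 < L → periodicGroundStateEnergy v N L ≠ ⊤ →
        ∀ ε : ℝ, 0 < ε → ∃ n₀ : ℕ, ∀ n : ℕ, n₀ ≤ n →
          periodicGroundStateEnergy v N L ≤ periodicGroundStateEnergy (w n) N L + ENNReal.ofReal ε := by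
  intro v hv w hwm hstep hsup N L hL hE ε hε
  have hmono : ∀ r, Monotone fun n => w n r := fun r => monotone_nat_of_le_succ fun n => hstep n r
  have hiSup := iSup_periodicGroundStateEnergy_tower hv hwm hmono hsup hL hE
  have htend : Tendsto (fun n : ℕ => periodicGroundStateEnergy (w n) N L) atTop
      (𝓝 (periodicGroundStateEnergy v N L)) :=
    hiSup ▸ tendsto_atTop_iSup (monotone_periodicGroundStateEnergy_family hmono N L)
  obtain ⟨n₀, hn₀⟩ := (ENNReal.tendsto_atTop hE).1 htend (ENNReal.ofReal ε) (ENNReal.ofReal_pos.2 hε)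
  exact ⟨n₀, fun n hn => tsub_le_iff_right.1 (hn₀ n hn).1⟩

end Summit.AtomisticToContinuum.BoseEinsteinCondensation.Cruxes.HardCoreExtension.NearMinTower

end
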